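import Summits.MatrixMultiplication.MatrixMultiplication.Theses.CondensationDistance

/-!
# Route `CondensationDistance` — support item `TightToShort` (stmt-MatrixMultiplication-15942)

`TightCondensation → ShortCondensation`: a tight derivation (no auxiliary columns beyond the `n` target
columns, ground set `Fin (n + n)`) is a short one with auxiliary width `m' = n ≤ n ^ 1`, and the targets
`{n ≤ x}` and `{n ≤ x < 2n}` coincide on `Fin (n + n)`.  Pure logic. [folklore]
-/

set_option linter.dupNamespace false

namespace Summit.MatrixMultiplication.MatrixMultiplication.Theorems.ShortCondensation

open Summit.MatrixMultiplication.MatrixMultiplication.Theses.CondensationDistance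

/-- **Support item `TightToShort`** (stmt-MatrixMultiplication-15942,
`TightCondensation → ShortCondensation`), BY NAME: a tight derivation is a short one with `m' = n ≤ n ^ 1`
auxiliary width; the targets `{n ≤ x}` and `{n ≤ x < 2n}` coincide on `Fin (n + n)`. [folklore] -/
theorem TightToShort_proof : TightToShort := by
  intro hT ε hε
  obtain ⟨n₀, hn₀⟩ := hT ε hε
  refine ⟨1, n₀, fun n hn => ⟨n, le_rfl, by simp, ?_⟩⟩
  obtain ⟨l, f, hl, hv, i, hi⟩ := hn₀ n hn
  refine ⟨l, f, hl, hv, i, ?_⟩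
  rw [hi]
  refine Finset.filter_congr fun x _ => ⟨fun h => ⟨h, ?_⟩, fun h => h.1⟩
  have hx := x.isLt
  omega

end Summit.MatrixMultiplication.MatrixMultiplication.Theorems.ShortCondensation
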